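import Literature.MathematicalPhysics.QuantumFieldTheory.Balaban1983to89.Setup

/-!
# `Balaban1983to89.B15Prop1NumericsThresholds` — [Balaban1989LargeFieldI] Prop. 1 p. 194 («for ε > 0 sufficiently small») ∕
# [Balaban1989LargeFieldII] (1.7)–(1.9) p. 358: THE NUMERICS LETTERS `hsm` ∕ `hγle` OF THE N12∕s1 ENDPOINT ARE INHABITABLE —
# explicit smallness thresholds, the uniform positivity constant, and the order in which the instance's small parameters are chosen

Honest framing: statement-level skeleton of published theorems with citation tags; proofs where landed; nothing here is a claim about
the Yang–Mills mass gap.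

Cell `pub-ymgap`, HUMAN RULINGS D-0062 ∕ D-0149, node N12 = [B15], lane-owner seat `pub-ymgap-dag-n12-c` (g19, R134 s1);
count-neutral helper of K1⁹ `stmt-QuantumFields-27364`.  PURE REAL ARITHMETIC over the TEXT of the two numerics letters displayed by the
N12∕s1 endpoint of record (`B15Prop1EndpointFromLetterFamilies.…_ofGaugeChartLetters_ofCoercive`, dag-n12-w5 p628231, ll. 196–199; the same text
in `B15Prop1CoerciveAtNormalisedDatum` §3–§5 and `B15Prop1EndpointNearFlatLetters`; and, with `γ₀ := 1` and the chart constants substituted, in the Summits-side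
chart-constants endpoint `…N12Prop1OfGaugeLetterAndChartConstants`, p631882 — §3 below targets BOTH spellings):

* `hsm : ∀ i, (32(d−1)·δc i + μc i + 16(d−1)·(ρc i·δ₂c i)·(2 + ρc i·δ₂c i))·Kc i² + τc i ≤ γ₀ ∕ (2(3K_i² + 2K_i⁴))`,
* `hγle : ∀ i, γ ∕ M_i⁵ ≤ γ₀ ∕ (2(3K_i² + 2K_i⁴))`.

THE POINT (print: Prop. 1 holds «for ε > 0 sufficiently small», the threshold being allowed to depend on the instance — the weakest reading typed in
`B15.Prop1Printed`, `∃ B₅, ∀ i, ∃ e0 > 0, …`).  In the chart letter of record (dag-n12-w4 `…N12NearFlatChartLetter.chartLetter_of_letters`, p630404) ONLY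
`μc = Cμ·δ`, `δ₂c = C₂·δ`, `τc = Cτ′·δ` scale with the near-flatness `δ := max δc δin` of the gauged minimiser, while `ρc` (whatever its size — dag-n10-w1's
LOCATED-RHO floor included), `Kc = 12𝓐₀∕R·√N₁`, the Schur size `K` and `γ₀` are `δ`-FREE per-instance constants.  Hence (§2–§3) `hsm` holds for EVERY
`δ` below an explicit positive threshold `δ₀(i)`, and (§1) `hγle` holds UNIFORMLY in the instance with `γ := γ₀·(12d)²∕(10·bx²)` once `K_i := n_i + 1` and the
endpoint's own box letter `hbxM : 12d(n_i+2)² ≤ bx·M_i²` are used; (§4) the guard `eR i` is then chosen LAST, below a reference guard `eR₀ i` at which (J0′)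
was read (the guard is antitone, §5) and below `δ₀(i)` through the gauge letter's linear moduli.  ASSEMBLY ORDER per instance (lane word, cell bus 2026-08-28
12:02Z): (1) chart constants; (2) (J0′) at a reference guard ⇒ `R`, `𝓐₀`; (3) `Kc`, `S_i`, `δ₀(i)`; (4) `eR i`; (5) `ρn`, `K`, `γ`, bookkeeping sups.

WHAT THIS FILE PROVES (theorems only — no `def`, no `instance`, no `sorry`; axioms standard):
* §1 `toNat_side_le_succ` (box sides `(hi−lo+1).toNat ≤ n+1` from `hi ≤ lo+n`), `sq_bound_of_hbxM` (`12d(n+1)² ≤ bx·M²` from `hbxM`), ★ `hγle_of_sq_le`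
  (the `hγle` body at `γ := γ₀(12d)²∕(10bx²)` from `12d·K² ≤ bx·M²`, `1 ≤ K`, `1 ≤ M`), ★ `hγle_family` (the endpoint's `hγle` for a whole family at `K_i := n_i+1`),
  `gamma_pos` (that `γ` is positive with `γ₀`), ★ `hγle_family_one` ∕ `gamma_one_pos` (the `γ₀ := 1` chart-constants endpoint, p631882).
* §2 ★★ `hsm_of_moduli_of_le` — the `hsm` body from `δc ≤ δ`, `μc ≤ Cμ·δ`, `δ₂c ≤ C₂·δ`, `τc ≤ Cτ·δ`, `δ ≤ 1` and ONE scalar inequality `δ·S ≤ rhs`,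
  `S := (32(d−1) + Cμ + 16(d−1)·(ρc·C₂)·(2 + ρc·C₂))·Kc² + Cτ`.
* §3 ★★ `exists_smallness_threshold` (any `S`, `0 < rhs` ⇒ `∃ δ₀ ∈ (0,1]`, `∀ δ ∈ [0,δ₀]`, `δ·S ≤ rhs`), `rhs_pos` (`0 < γ₀ ∕ (2(3K²+2K⁴))`),
  ★★★ `exists_delta_hsm` ∕ `exists_delta_hsm_family` (for `δ`-free constants `ρc C₂ ≥ 0`, `Kc Cμ Cτ`, `γ₀ > 0`, `1 ≤ K`: a threshold `δ₀ ∈ (0,1]` below which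
  the `hsm` body holds for all moduli-bounded `δc μc δ₂c τc`), ★★★ `hsm_chartConstants_of_le` ∕ `exists_delta_hsm_chartConstants_family` (the SAME for the
  `hsm` TEXT of the chart-constants endpoint p631882: `γ₀ := 1`, `μc := Cμ·max δc δin`, `δ₂c := C₂·max δc δin`, `τc := 16(d+1)(Cτ·max δc δin)`).
* §4 ★ `exists_eR_of_linear_moduli` (step (4): `∃ eR ∈ (0, eR₀]` with `Cσ·eR ≤ δ₀`, `Cin·eR ≤ δ₀`, `eR ≤ δ₀`).
* §5 `guard_antitone` (a letter read at every base field of the guard `PlaqSmallOn S e` is read at every base field of any smaller guard).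
* §6 (v1.1, the DIRECT road of plan g87's ruling) ★★ `hsm_direct_of_moduli_of_le`, ★★★ `exists_delta_hsm_direct` ∕ `exists_delta_hsm_direct_family` (the direct socket's
  `hsm` body `(32(d−1)δc + 8(d−1)εc + μc)·Kc² + τc ≤ γ₀∕(2(3K²+2K⁴))` from linear moduli `δc ≤ δ`, `εc ≤ Cε·δ`, `μc ≤ Cμ·δ`, `τc ≤ Cτ·δ`, threshold by `choose`),
  ★★ `hsm_direct_of_moduli_of_fixed_plaq` (the class road: `εc` fixed, two displayed scalar inequalities).
* §7 (v1.2, lane finding LOCATED-FLOOR 2026-08-28T22:10Z) ★★★ `hsm_direct_of_le_explicitThreshold` ∕ `explicitThreshold_pos` ∕ `explicitThreshold_le_one`: the direct threshold as a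
  CLOSED-FORM expression `min 1 (rhs ∕ (max S 0 + 1))` — NO `∃`.  WHY: an endpoint of the shape `∃ δ₀ > 0, ∀ δ ≤ δ₀, (floor ≤ δ) → …` whose floor is a positive real fixed by
  OUTER binders (the class threshold `εreg`, the datum tolerance `ρn`) is vacuous by shape (`δ₀ := floor ∕ 2`); with the explicit threshold the endpoint is stated as
  `∀ δ ≤ Θ(explicit), floor ≤ δ → …` and the displayed price `floor ≤ Θ` is an honest, checkable inequality.

HONEST SCOPE.  Arithmetic over DISPLAYED letters: it discharges the numerics letters GIVEN producers whose constants have the stated `δ`-dependence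
(dag-n12-w4's (χ): yes, by its statement; the gauge letter (σ): linear moduli in the guard are the shape asked of its producers, not proved here).
Nothing of Bałaban's (1.7) ∕ (1.12) ∕ Prop. 1 ∕ [Balaban1985Variational] (16)–(18) is asserted; count-neutral; N12 NOT discharged; K1⁹ NOT closed; one
finite four-torus programme at fixed `ε = L^{-K}` — nothing continuum ∕ ℝ⁴ ∕ OS ∕ mass gap ∕ Clay.

## References
* [Balaban1989LargeFieldI] T. Bałaban, Commun. Math. Phys. 122 (1989) 175–202, Prop. 1 (1.77)–(1.78) p. 194 («for ε > 0 sufficiently small»), (1.79) p. 195.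
* [Balaban1989LargeFieldII] T. Bałaban, Commun. Math. Phys. 122 (1989) 355–392, (1.7)–(1.9) p. 358, (1.12)–(1.13) p. 359.
-/

noncomputable section

namespace Literature.MathematicalPhysics.QuantumFieldTheory.Balaban1983to89.B15Prop1NumericsThresholds

/-! ## §1  The positivity constant: `hγle` uniformly in the instance -/

section GammaLe

/-- Box sides: from `hi κ ≤ lo κ + n` the side `(hi κ − lo κ + 1).toNat` is at most `n + 1` — the endpoint's `hKn` at `K := n + 1`.
[cite: Balaban1989LargeFieldI, (1.74) p.192 (bookkeeping)] -/
theorem toNat_side_le_succ {m : ℕ} {lo hi : Fin m → ℤ} {n : ℕ} (hn : ∀ κ, hi κ ≤ lo κ + n) (κ : Fin m) :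
    (hi κ - lo κ + 1).toNat ≤ n + 1 := by
  have h := hn κ
  have h' : hi κ - lo κ + 1 ≤ ((n + 1 : ℕ) : ℤ) := by push_cast; linarith
  exact Int.toNat_le.mpr h'

/-- From the endpoint's box letter `12d(n+2)² ≤ bx·M²` the Schur size `K := n + 1` satisfies `12d·K² ≤ bx·M²`.
[cite: Balaban1989LargeFieldI, (1.74) p.192 (bookkeeping)] -/
theorem sq_bound_of_hbxM {d n : ℕ} {bx M : ℝ} (hbxM : 12 * (d : ℝ) * ((n : ℝ) + 2) ^ 2 ≤ bx * M ^ 2) :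
    12 * (d : ℝ) * (((n + 1 : ℕ) : ℝ)) ^ 2 ≤ bx * M ^ 2 := by
  have hd : (0 : ℝ) ≤ 12 * (d : ℝ) := by positivity
  have hsq : (((n + 1 : ℕ) : ℝ)) ^ 2 ≤ ((n : ℝ) + 2) ^ 2 := by
    push_cast
    nlinarith [Nat.cast_nonneg (α := ℝ) n]
  exact (mul_le_mul_of_nonneg_left hsq hd).trans hbxM

/-- ★ **`hγle` AT THE UNIFORM CONSTANT.**  If `12d·K² ≤ bx·M²` with `1 ≤ K`, `1 ≤ M`, `0 < bx`, `0 ≤ γ₀`, then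
`γ₀(12d)²∕(10bx²) ∕ M⁵ ≤ γ₀ ∕ (2(3K² + 2K⁴))` — the endpoint's `hγle` body at `γ := γ₀·(12d)²∕(10·bx²)`, a constant NOT depending on the instance.
Proof: `2(3K²+2K⁴) ≤ 10K⁴`, `(12d)²K⁴ ≤ bx²M⁴ ≤ bx²M⁵`. [cite: Balaban1989LargeFieldII, (1.9) p.358 (bookkeeping of the positivity constant)] -/
theorem hγle_of_sq_le {d K : ℕ} {γ₀ bx M : ℝ} (hγ₀ : 0 ≤ γ₀) (hbx : 0 < bx) (hM : 1 ≤ M) (hK : 1 ≤ K)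
    (hKM : 12 * (d : ℝ) * (K : ℝ) ^ 2 ≤ bx * M ^ 2) :
    γ₀ * (12 * (d : ℝ)) ^ 2 / (10 * bx ^ 2) / M ^ 5 ≤ γ₀ / (2 * (3 * (K : ℝ) ^ 2 + 2 * (K : ℝ) ^ 4)) := by
  have hK' : (1 : ℝ) ≤ (K : ℝ) := by exact_mod_cast hK
  have hM0 : (0 : ℝ) < M := lt_of_lt_of_le one_pos hM
  have hK2 : (1 : ℝ) ≤ (K : ℝ) ^ 2 := by nlinarith
  have hD : (0 : ℝ) < 2 * (3 * (K : ℝ) ^ 2 + 2 * (K : ℝ) ^ 4) := by positivity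
  have hden : (0 : ℝ) < 10 * bx ^ 2 * M ^ 5 := by positivity
  rw [div_div, div_le_div_iff₀ hden hD]
  -- `γ₀ (12d)² · 2(3K²+2K⁴) ≤ γ₀ · (10 bx² M⁵)`
  have hA0 : (0 : ℝ) ≤ 12 * (d : ℝ) * (K : ℝ) ^ 2 := by positivity
  have hsq : (12 * (d : ℝ) * (K : ℝ) ^ 2) ^ 2 ≤ (bx * M ^ 2) ^ 2 :=
    pow_le_pow_left₀ hA0 hKM 2
  have hM4 : M ^ 4 ≤ M ^ 5 := pow_le_pow_right₀ hM (by norm_num)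
  have hK24 : (K : ℝ) ^ 2 ≤ (K : ℝ) ^ 4 := by nlinarith
  have hkey : (12 * (d : ℝ)) ^ 2 * (2 * (3 * (K : ℝ) ^ 2 + 2 * (K : ℝ) ^ 4)) ≤ 10 * bx ^ 2 * M ^ 5 := by
    have h1 : (12 * (d : ℝ)) ^ 2 * (2 * (3 * (K : ℝ) ^ 2 + 2 * (K : ℝ) ^ 4))
        ≤ (12 * (d : ℝ)) ^ 2 * (10 * (K : ℝ) ^ 4) := by
      apply mul_le_mul_of_nonneg_left _ (by positivity)
      nlinarith
    have h2 : (12 * (d : ℝ)) ^ 2 * (10 * (K : ℝ) ^ 4) = 10 * (12 * (d : ℝ) * (K : ℝ) ^ 2) ^ 2 := by ring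
    have h3 : 10 * (12 * (d : ℝ) * (K : ℝ) ^ 2) ^ 2 ≤ 10 * (bx * M ^ 2) ^ 2 := by linarith
    have h4 : 10 * (bx * M ^ 2) ^ 2 = 10 * bx ^ 2 * M ^ 4 := by ring
    have h5 : 10 * bx ^ 2 * M ^ 4 ≤ 10 * bx ^ 2 * M ^ 5 :=
      mul_le_mul_of_nonneg_left hM4 (by positivity)
    linarith
  calc γ₀ * (12 * (d : ℝ)) ^ 2 * (2 * (3 * (K : ℝ) ^ 2 + 2 * (K : ℝ) ^ 4))
      = γ₀ * ((12 * (d : ℝ)) ^ 2 * (2 * (3 * (K : ℝ) ^ 2 + 2 * (K : ℝ) ^ 4))) := by ring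
    _ ≤ γ₀ * (10 * bx ^ 2 * M ^ 5) := mul_le_mul_of_nonneg_left hkey hγ₀

/-- The uniform constant `γ := γ₀·(12d)²∕(10·bx²)` is positive with `γ₀` (`1 ≤ d`, `0 < bx`). [cite: Balaban1989LargeFieldII, (1.9) p.358 (bookkeeping)] -/
theorem gamma_pos {d : ℕ} (hd : 1 ≤ d) {γ₀ bx : ℝ} (hγ₀ : 0 < γ₀) (hbx : 0 < bx) :
    0 < γ₀ * (12 * (d : ℝ)) ^ 2 / (10 * bx ^ 2) := by
  have : (0 : ℝ) < (d : ℝ) := by exact_mod_cast hd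
  positivity

/-- ★ **THE ENDPOINT'S `hγle` FOR A WHOLE INSTANCE FAMILY**, at `K_i := n_i + 1` and the uniform `γ := γ₀·(12d)²∕(10·bx²)`, from the endpoint's own
letters `hbxM : 12d(n_i+2)² ≤ bx·M_i²`, `hM : 1 ≤ M_i` (`0 < bx`, `0 ≤ γ₀`).
[cite: Balaban1989LargeFieldII, (1.9) p.358 (bookkeeping of the positivity constant); Balaban1989LargeFieldI, Prop. 1 (1.78) p.194] -/
theorem hγle_family {ι : Type*} {d : ℕ} {γ₀ bx : ℝ} (hγ₀ : 0 ≤ γ₀) (hbx : 0 < bx)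
    (n : ι → ℕ) (M : ι → ℝ) (hM : ∀ i, 1 ≤ M i)
    (hbxM : ∀ i, 12 * (d : ℝ) * ((n i : ℝ) + 2) ^ 2 ≤ bx * M i ^ 2) :
    ∀ i, γ₀ * (12 * (d : ℝ)) ^ 2 / (10 * bx ^ 2) / M i ^ 5
      ≤ γ₀ / (2 * (3 * (((n i + 1 : ℕ) : ℝ)) ^ 2 + 2 * (((n i + 1 : ℕ) : ℝ)) ^ 4)) :=
  fun i => hγle_of_sq_le hγ₀ hbx (hM i) (Nat.succ_le_succ (Nat.zero_le _)) (sq_bound_of_hbxM (hbxM i))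


/-- ★ **THE CHART-CONSTANTS ENDPOINT's `hγle` (`γ₀ := 1`) FOR A WHOLE INSTANCE FAMILY** at `K_i := n_i + 1`, `γ := (12d)²∕(10·bx²)`.
[cite: Balaban1989LargeFieldII, (1.9) p.358 (bookkeeping of the positivity constant); Balaban1989LargeFieldI, Prop. 1 (1.78) p.194] -/
theorem hγle_family_one {ι : Type*} {d : ℕ} {bx : ℝ} (hbx : 0 < bx)
    (n : ι → ℕ) (M : ι → ℝ) (hM : ∀ i, 1 ≤ M i)
    (hbxM : ∀ i, 12 * (d : ℝ) * ((n i : ℝ) + 2) ^ 2 ≤ bx * M i ^ 2) :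
    ∀ i, (12 * (d : ℝ)) ^ 2 / (10 * bx ^ 2) / M i ^ 5
      ≤ 1 / (2 * (3 * (((n i + 1 : ℕ) : ℝ)) ^ 2 + 2 * (((n i + 1 : ℕ) : ℝ)) ^ 4)) := by
  intro i
  have h := hγle_family zero_le_one hbx n M hM hbxM i
  simpa only [one_mul] using h

/-- The `γ₀ := 1` constant `(12d)²∕(10·bx²)` is positive (`1 ≤ d`, `0 < bx`). [cite: Balaban1989LargeFieldII, (1.9) p.358 (bookkeeping)] -/
theorem gamma_one_pos {d : ℕ} (hd : 1 ≤ d) {bx : ℝ} (hbx : 0 < bx) : 0 < (12 * (d : ℝ)) ^ 2 / (10 * bx ^ 2) := by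
  have : (0 : ℝ) < (d : ℝ) := by exact_mod_cast hd
  positivity

end GammaLe

/-! ## §2  The smallness letter `hsm` from moduli -/

section Hsm

/-- ★★ **`hsm` FROM MODULI AND ONE SCALAR INEQUALITY.**  If `δc ≤ δ`, `μc ≤ Cμ·δ`, `δ₂c ≤ C₂·δ`, `τc ≤ Cτ·δ` with `0 ≤ δ ≤ 1`
(`0 ≤ δ₂c, ρc, C₂`, `1 ≤ d`) and `δ·S ≤ rhs` for `S := (32(d−1) + Cμ + 16(d−1)·(ρc·C₂)·(2 + ρc·C₂))·Kc² + Cτ`, then the endpoint's `hsm` body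
`(32(d−1)·δc + μc + 16(d−1)·(ρc·δ₂c)·(2 + ρc·δ₂c))·Kc² + τc ≤ rhs` holds.
[cite: Balaban1989LargeFieldII, (1.7)–(1.9) p.358 (bookkeeping of the error constant); Balaban1989LargeFieldI, Prop. 1 p.194 («for ε > 0 sufficiently small»)] -/
theorem hsm_of_moduli_of_le {d : ℕ} (hd : 1 ≤ d) {δ δc μc ρc δ₂c Kc τc Cμ C₂ Cτ rhs : ℝ}
    (hδ0 : 0 ≤ δ) (hδ1 : δ ≤ 1) (hδc : δc ≤ δ) (hμc : μc ≤ Cμ * δ)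
    (hρc : 0 ≤ ρc) (hδ₂0 : 0 ≤ δ₂c) (hδ₂ : δ₂c ≤ C₂ * δ) (hC₂ : 0 ≤ C₂) (hτ : τc ≤ Cτ * δ)
    (hS : δ * ((32 * ((d : ℝ) - 1) + Cμ + 16 * ((d : ℝ) - 1) * (ρc * C₂) * (2 + ρc * C₂)) * Kc ^ 2 + Cτ) ≤ rhs) :
    (32 * ((d : ℝ) - 1) * δc + μc + 16 * ((d : ℝ) - 1) * (ρc * δ₂c) * (2 + ρc * δ₂c)) * Kc ^ 2 + τc ≤ rhs := by
  have hd' : (0 : ℝ) ≤ (d : ℝ) - 1 := by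
    have : (1 : ℝ) ≤ (d : ℝ) := by exact_mod_cast hd
    linarith
  -- term 1
  have h1 : 32 * ((d : ℝ) - 1) * δc ≤ 32 * ((d : ℝ) - 1) * δ :=
    mul_le_mul_of_nonneg_left hδc (by positivity)
  -- term 3: `x := ρc δ₂c ≤ y := ρc C₂ δ ≤ ρc C₂`, and `x(2+x) ≤ δ · (ρc C₂)(2 + ρc C₂)`
  have hx0 : 0 ≤ ρc * δ₂c := mul_nonneg hρc hδ₂0
  have hxy : ρc * δ₂c ≤ ρc * C₂ * δ := by
    have := mul_le_mul_of_nonneg_left hδ₂ hρc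
    linarith [this]
  have hyz : ρc * C₂ * δ ≤ ρc * C₂ := by
    have h := mul_le_mul_of_nonneg_left hδ1 (mul_nonneg hρc hC₂)
    simpa using h
  have hxz : ρc * δ₂c ≤ ρc * C₂ := hxy.trans hyz
  have h3 : (ρc * δ₂c) * (2 + ρc * δ₂c) ≤ δ * ((ρc * C₂) * (2 + ρc * C₂)) := by
    -- `x(2+x) ≤ y(2+x) ≤ y(2+z)` with `y = ρc C₂ δ`, `z = ρc C₂`
    have ha : (ρc * δ₂c) * (2 + ρc * δ₂c) ≤ (ρc * C₂ * δ) * (2 + ρc * δ₂c) :=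
      mul_le_mul_of_nonneg_right hxy (by linarith)
    have hb : (ρc * C₂ * δ) * (2 + ρc * δ₂c) ≤ (ρc * C₂ * δ) * (2 + ρc * C₂) :=
      mul_le_mul_of_nonneg_left (by linarith) (mul_nonneg (mul_nonneg hρc hC₂) hδ0)
    have hc : (ρc * C₂ * δ) * (2 + ρc * C₂) = δ * ((ρc * C₂) * (2 + ρc * C₂)) := by ring
    linarith
  have h3' : 16 * ((d : ℝ) - 1) * (ρc * δ₂c) * (2 + ρc * δ₂c)
      ≤ 16 * ((d : ℝ) - 1) * (δ * ((ρc * C₂) * (2 + ρc * C₂))) := by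
    have := mul_le_mul_of_nonneg_left h3 (show (0 : ℝ) ≤ 16 * ((d : ℝ) - 1) by positivity)
    simpa [mul_assoc] using this
  -- the bracket
  have hbr : 32 * ((d : ℝ) - 1) * δc + μc + 16 * ((d : ℝ) - 1) * (ρc * δ₂c) * (2 + ρc * δ₂c)
      ≤ δ * (32 * ((d : ℝ) - 1) + Cμ + 16 * ((d : ℝ) - 1) * (ρc * C₂) * (2 + ρc * C₂)) := by
    have he : δ * (32 * ((d : ℝ) - 1) + Cμ + 16 * ((d : ℝ) - 1) * (ρc * C₂) * (2 + ρc * C₂))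
        = 32 * ((d : ℝ) - 1) * δ + Cμ * δ + 16 * ((d : ℝ) - 1) * (δ * ((ρc * C₂) * (2 + ρc * C₂))) := by ring
    rw [he]; linarith
  have hbrK : (32 * ((d : ℝ) - 1) * δc + μc + 16 * ((d : ℝ) - 1) * (ρc * δ₂c) * (2 + ρc * δ₂c)) * Kc ^ 2
      ≤ δ * (32 * ((d : ℝ) - 1) + Cμ + 16 * ((d : ℝ) - 1) * (ρc * C₂) * (2 + ρc * C₂)) * Kc ^ 2 :=
    mul_le_mul_of_nonneg_right hbr (sq_nonneg _)
  have he2 : δ * (32 * ((d : ℝ) - 1) + Cμ + 16 * ((d : ℝ) - 1) * (ρc * C₂) * (2 + ρc * C₂)) * Kc ^ 2 + Cτ * δ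
      = δ * ((32 * ((d : ℝ) - 1) + Cμ + 16 * ((d : ℝ) - 1) * (ρc * C₂) * (2 + ρc * C₂)) * Kc ^ 2 + Cτ) := by ring
  linarith

end Hsm

/-! ## §3  Existence of the threshold -/

section Threshold

/-- ★★ **A POSITIVE SMALLNESS THRESHOLD.**  For any real `S` and `0 < rhs` there is `δ₀ ∈ (0, 1]` with `δ·S ≤ rhs` for every `δ ∈ [0, δ₀]`
(`δ₀ := min 1 (rhs ∕ (|S| + 1))`). [cite: Balaban1989LargeFieldI, Prop. 1 p.194 («for ε > 0 sufficiently small»; bookkeeping)] -/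
theorem exists_smallness_threshold (S : ℝ) {rhs : ℝ} (hrhs : 0 < rhs) :
    ∃ δ₀ : ℝ, 0 < δ₀ ∧ δ₀ ≤ 1 ∧ ∀ δ : ℝ, 0 ≤ δ → δ ≤ δ₀ → δ * S ≤ rhs := by
  have hS1 : (0 : ℝ) < |S| + 1 := by positivity
  refine ⟨min 1 (rhs / (|S| + 1)), lt_min one_pos (div_pos hrhs hS1), min_le_left _ _, fun δ hδ0 hδ => ?_⟩
  have hδ' : δ ≤ rhs / (|S| + 1) := hδ.trans (min_le_right _ _)
  have h1 : δ * S ≤ δ * (|S| + 1) := mul_le_mul_of_nonneg_left (by linarith [le_abs_self S]) hδ0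
  have h2 : δ * (|S| + 1) ≤ rhs / (|S| + 1) * (|S| + 1) := mul_le_mul_of_nonneg_right hδ' hS1.le
  rw [div_mul_cancel₀ _ hS1.ne'] at h2
  linarith

/-- The right-hand side `γ₀ ∕ (2(3K² + 2K⁴))` of `hsm`∕`hγle` is positive for `0 < γ₀`, `1 ≤ K`. [cite: Balaban1989LargeFieldII, (1.9) p.358 (bookkeeping)] -/
theorem rhs_pos {K : ℕ} (hK : 1 ≤ K) {γ₀ : ℝ} (hγ₀ : 0 < γ₀) :
    0 < γ₀ / (2 * (3 * (K : ℝ) ^ 2 + 2 * (K : ℝ) ^ 4)) := by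
  have : (1 : ℝ) ≤ (K : ℝ) := by exact_mod_cast hK
  positivity

/-- ★★★ **THE `hsm` LETTER IS INHABITABLE: for `δ`-free constants there is a positive near-flatness threshold.**  For `1 ≤ d`, `1 ≤ K`,
`0 ≤ ρc, C₂`, any `Kc Cμ Cτ`, and `0 < γ₀` there is `δ₀ ∈ (0, 1]` such that for every `δ ∈ [0, δ₀]` and all `δc μc δ₂c τc` with
`δc ≤ δ`, `μc ≤ Cμ·δ`, `0 ≤ δ₂c ≤ C₂·δ`, `τc ≤ Cτ·δ` the endpoint's `hsm` body
`(32(d−1)·δc + μc + 16(d−1)·(ρc·δ₂c)·(2 + ρc·δ₂c))·Kc² + τc ≤ γ₀ ∕ (2(3K² + 2K⁴))` holds — the instance's «ε sufficiently small».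
In the chart letter of record `μc = Cμ·max δc δin`, `δ₂c = C₂·max δc δin`, `τc = (16(d+1)Cτ)·max δc δin`, so `δ := max δc δin` serves.
[cite: Balaban1989LargeFieldI, Prop. 1 p.194 («for ε > 0 sufficiently small»); Balaban1989LargeFieldII, (1.7)–(1.9) p.358 (bookkeeping)] -/
theorem exists_delta_hsm {d K : ℕ} (hd : 1 ≤ d) (hK : 1 ≤ K) {ρc C₂ γ₀ : ℝ} (Kc Cμ Cτ : ℝ)
    (hρc : 0 ≤ ρc) (hC₂ : 0 ≤ C₂) (hγ₀ : 0 < γ₀) :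
    ∃ δ₀ : ℝ, 0 < δ₀ ∧ δ₀ ≤ 1 ∧ ∀ δ δc μc δ₂c τc : ℝ, 0 ≤ δ → δ ≤ δ₀ →
      δc ≤ δ → μc ≤ Cμ * δ → 0 ≤ δ₂c → δ₂c ≤ C₂ * δ → τc ≤ Cτ * δ →
      (32 * ((d : ℝ) - 1) * δc + μc + 16 * ((d : ℝ) - 1) * (ρc * δ₂c) * (2 + ρc * δ₂c)) * Kc ^ 2 + τc
        ≤ γ₀ / (2 * (3 * (K : ℝ) ^ 2 + 2 * (K : ℝ) ^ 4)) := by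
  obtain ⟨δ₀, hδ₀, hδ₀1, hall⟩ :=
    exists_smallness_threshold ((32 * ((d : ℝ) - 1) + Cμ + 16 * ((d : ℝ) - 1) * (ρc * C₂) * (2 + ρc * C₂)) * Kc ^ 2 + Cτ) (rhs_pos hK hγ₀)
  refine ⟨δ₀, hδ₀, hδ₀1, fun δ δc μc δ₂c τc hδ hδle hδc hμc hδ₂0 hδ₂ hτ => ?_⟩
  exact hsm_of_moduli_of_le hd hδ (hδle.trans hδ₀1) hδc hμc hρc hδ₂0 hδ₂ hC₂ hτ (hall δ hδ hδle)

/-- ★★★ **THE SAME FOR AN INSTANCE FAMILY**: per instance `i` a threshold `δ₀ i ∈ (0,1]` (by `choose`), for `δ`-free families of constants.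
[cite: Balaban1989LargeFieldI, Prop. 1 p.194 («for ε > 0 sufficiently small», the threshold may depend on the instance); Balaban1989LargeFieldII, (1.7)–(1.9) p.358] -/
theorem exists_delta_hsm_family {ι : Type*} {d : ℕ} (hd : 1 ≤ d) (K : ι → ℕ) (hK : ∀ i, 1 ≤ K i)
    {ρc C₂ : ι → ℝ} (Kc Cμ Cτ : ι → ℝ) {γ₀ : ℝ}
    (hρc : ∀ i, 0 ≤ ρc i) (hC₂ : ∀ i, 0 ≤ C₂ i) (hγ₀ : 0 < γ₀) :
    ∃ δ₀ : ι → ℝ, (∀ i, 0 < δ₀ i) ∧ (∀ i, δ₀ i ≤ 1) ∧ ∀ i (δ δc μc δ₂c τc : ℝ), 0 ≤ δ → δ ≤ δ₀ i →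
      δc ≤ δ → μc ≤ Cμ i * δ → 0 ≤ δ₂c → δ₂c ≤ C₂ i * δ → τc ≤ Cτ i * δ →
      (32 * ((d : ℝ) - 1) * δc + μc + 16 * ((d : ℝ) - 1) * (ρc i * δ₂c) * (2 + ρc i * δ₂c)) * Kc i ^ 2 + τc
        ≤ γ₀ / (2 * (3 * (K i : ℝ) ^ 2 + 2 * (K i : ℝ) ^ 4)) := by
  choose δ₀ h0 h1 hall using fun i => exists_delta_hsm hd (hK i) (Kc i) (Cμ i) (Cτ i) (hρc i) (hC₂ i) hγ₀
  exact ⟨δ₀, h0, h1, hall⟩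


/-- ★★★ **THE `hsm` LETTER OF THE CHART-CONSTANTS ENDPOINT** (dag-n12-w5's
`…N12Prop1OfGaugeLetterAndChartConstants.…_ofGaugeLetter_ofChartConstants_ofCoercive`, p631882: `γ₀ := 1`, `μc := Cμ·max δc δin`, `ρc := Cρ`,
`δ₂c := C₂·max δc δin`, `τc := 16(d+1)·(Cτ·max δc δin)`, `Kc` the velocity constant `12𝓐₀∕R·√N₁` — any real here) FROM ONE SCALAR INEQUALITY on
`m := max δc δin ≤ 1`: `m·S ≤ 1∕(2(3K²+2K⁴))` with `S := (32(d−1) + Cμ + 16(d−1)(Cρ·C₂)(2 + Cρ·C₂))·Kc² + 16(d+1)·Cτ`.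
[cite: Balaban1989LargeFieldII, (1.7)–(1.9) p.358 (bookkeeping of the error constant); Balaban1989LargeFieldI, Prop. 1 p.194] -/
theorem hsm_chartConstants_of_le {d K : ℕ} (hd : 1 ≤ d) {δc δin Cμ Cρ C₂ Cτ Kc : ℝ}
    (hδc0 : 0 ≤ δc) (hm1 : max δc δin ≤ 1) (hCρ : 0 ≤ Cρ) (hC₂ : 0 ≤ C₂)
    (hS : max δc δin * ((32 * ((d : ℝ) - 1) + Cμ + 16 * ((d : ℝ) - 1) * (Cρ * C₂) * (2 + Cρ * C₂)) * Kc ^ 2 + 16 * ((d : ℝ) + 1) * Cτ)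
      ≤ 1 / (2 * (3 * (K : ℝ) ^ 2 + 2 * (K : ℝ) ^ 4))) :
    (32 * ((d : ℝ) - 1) * δc + Cμ * max δc δin
        + 16 * ((d : ℝ) - 1) * (Cρ * (C₂ * max δc δin)) * (2 + Cρ * (C₂ * max δc δin))) * Kc ^ 2
        + 16 * ((d : ℝ) + 1) * (Cτ * max δc δin)
      ≤ 1 / (2 * (3 * (K : ℝ) ^ 2 + 2 * (K : ℝ) ^ 4)) := by
  have hm0 : 0 ≤ max δc δin := hδc0.trans (le_max_left _ _)
  exact hsm_of_moduli_of_le hd hm0 hm1 (le_max_left _ _) le_rfl hCρ (mul_nonneg hC₂ hm0) le_rfl hC₂ (le_of_eq (by ring)) hS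

/-- ★★★ **THE `hsm` LETTER OF THE CHART-CONSTANTS ENDPOINT IS INHABITABLE, PER INSTANCE**: for `δ`-free families `K ≥ 1`, `Cρ, C₂ ≥ 0`, `Cμ Cτ Kc` (the
knit takes `Kc i := 12𝓐₀ i∕R i·√(Nat.card {b ∕∕ b.src ∈ Ω₁(Z_i)})`) there are thresholds `δ₀ i ∈ (0, 1]` such that the endpoint's `hsm i` holds whenever
`0 ≤ δc`, `max δc δin ≤ δ₀ i` — print's «for ε > 0 sufficiently small», the threshold depending on the instance.  Assembly: `choose` this BEFORE the guard `eR i`.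
[cite: Balaban1989LargeFieldI, Prop. 1 p.194 («for ε > 0 sufficiently small»); Balaban1989LargeFieldII, (1.7)–(1.9) p.358 (bookkeeping)] -/
theorem exists_delta_hsm_chartConstants_family {ι : Type*} {d : ℕ} (hd : 1 ≤ d) (K : ι → ℕ) (hK : ∀ i, 1 ≤ K i)
    {Cρ C₂ : ι → ℝ} (Kc Cμ Cτ : ι → ℝ) (hCρ : ∀ i, 0 ≤ Cρ i) (hC₂ : ∀ i, 0 ≤ C₂ i) :
    ∃ δ₀ : ι → ℝ, (∀ i, 0 < δ₀ i) ∧ (∀ i, δ₀ i ≤ 1) ∧ ∀ i (δc δin : ℝ), 0 ≤ δc → max δc δin ≤ δ₀ i →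
      (32 * ((d : ℝ) - 1) * δc + Cμ i * max δc δin
          + 16 * ((d : ℝ) - 1) * (Cρ i * (C₂ i * max δc δin)) * (2 + Cρ i * (C₂ i * max δc δin))) * Kc i ^ 2
          + 16 * ((d : ℝ) + 1) * (Cτ i * max δc δin)
        ≤ 1 / (2 * (3 * (K i : ℝ) ^ 2 + 2 * (K i : ℝ) ^ 4)) := by
  choose δ₀ h0 h1 hall using fun i =>
    exists_smallness_threshold
      ((32 * ((d : ℝ) - 1) + Cμ i + 16 * ((d : ℝ) - 1) * (Cρ i * C₂ i) * (2 + Cρ i * C₂ i)) * Kc i ^ 2 + 16 * ((d : ℝ) + 1) * Cτ i)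
      (rhs_pos (hK i) one_pos)
  refine ⟨δ₀, h0, h1, fun i δc δin hδc0 hm => ?_⟩
  have hm0 : 0 ≤ max δc δin := hδc0.trans (le_max_left _ _)
  exact hsm_chartConstants_of_le hd hδc0 (hm.trans (h1 i)) (hCρ i) (hC₂ i) (hall i _ hm0 hm)

end Threshold

/-! ## §4  The guard is chosen last -/

section Guard

/-- ★ **STEP (4) OF THE ASSEMBLY ORDER**: below a reference guard `eR₀ > 0` and a threshold `δ₀ > 0`, for linear moduli `Cσ, Cin ≥ 0` of the gauge
letter there is a guard `eR ∈ (0, eR₀]` with `Cσ·eR ≤ δ₀`, `Cin·eR ≤ δ₀` and `eR ≤ δ₀` (`eR := min eR₀ (δ₀ ∕ (max Cσ Cin + 1))`).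
[cite: Balaban1989LargeFieldI, Prop. 1 p.194 («for ε > 0 sufficiently small»; bookkeeping)] -/
theorem exists_eR_of_linear_moduli {eR₀ δ₀ Cσ Cin : ℝ} (heR₀ : 0 < eR₀) (hδ₀ : 0 < δ₀) (hCσ : 0 ≤ Cσ) (hCin : 0 ≤ Cin) :
    ∃ eR : ℝ, 0 < eR ∧ eR ≤ eR₀ ∧ Cσ * eR ≤ δ₀ ∧ Cin * eR ≤ δ₀ ∧ eR ≤ δ₀ := by
  have hm : (0 : ℝ) < max Cσ Cin + 1 := by
    have : (0 : ℝ) ≤ max Cσ Cin := le_max_of_le_left hCσ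
    linarith
  refine ⟨min eR₀ (δ₀ / (max Cσ Cin + 1)), lt_min heR₀ (div_pos hδ₀ hm), min_le_left _ _, ?_, ?_, ?_⟩
  · have h1 : Cσ * min eR₀ (δ₀ / (max Cσ Cin + 1)) ≤ Cσ * (δ₀ / (max Cσ Cin + 1)) :=
      mul_le_mul_of_nonneg_left (min_le_right _ _) hCσ
    have h2 : Cσ * (δ₀ / (max Cσ Cin + 1)) ≤ (max Cσ Cin + 1) * (δ₀ / (max Cσ Cin + 1)) :=
      mul_le_mul_of_nonneg_right (by linarith [le_max_left Cσ Cin]) (div_pos hδ₀ hm).le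
    rw [mul_div_cancel₀ _ hm.ne'] at h2
    linarith
  · have h1 : Cin * min eR₀ (δ₀ / (max Cσ Cin + 1)) ≤ Cin * (δ₀ / (max Cσ Cin + 1)) :=
      mul_le_mul_of_nonneg_left (min_le_right _ _) hCin
    have h2 : Cin * (δ₀ / (max Cσ Cin + 1)) ≤ (max Cσ Cin + 1) * (δ₀ / (max Cσ Cin + 1)) :=
      mul_le_mul_of_nonneg_right (by linarith [le_max_right Cσ Cin]) (div_pos hδ₀ hm).le
    rw [mul_div_cancel₀ _ hm.ne'] at h2
    linarith
  · have h1 : min eR₀ (δ₀ / (max Cσ Cin + 1)) ≤ δ₀ / (max Cσ Cin + 1) := min_le_right _ _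
    have h2 : δ₀ / (max Cσ Cin + 1) ≤ δ₀ := by
      rw [div_le_iff₀ hm]
      have : (0 : ℝ) ≤ max Cσ Cin := le_max_of_le_left hCσ
      nlinarith
    linarith

end Guard

/-! ## §5  The guard is antitone -/

section Antitone

variable {P : Params} {j : ℕ} {G : Type*} [GaugeGroup G]

/-- A smaller guard is a stronger hypothesis on the base field: `PlaqSmallOn S e' V → PlaqSmallOn S e V` for `e' ≤ e`.
[cite: Balaban1988Convergent, (1.4) p.247 (bookkeeping)] -/
theorem plaqSmallOn_of_le {S : Set (Plaq P j)} {e e' : ℝ} (h : e' ≤ e) {V : GaugeField P j G} (hV : PlaqSmallOn S e' V) :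
    PlaqSmallOn S e V :=
  fun p hp => (hV p hp).trans_le h

/-- ★ **GUARD ANTITONICITY OF A LETTER FAMILY** (step (2) of the assembly order: (J0′), (σ), (χ) read at a REFERENCE guard `e` stay valid at every
smaller guard `e' ≤ e`): if a conclusion `Q V` is available at every base field `V` of the guard `PlaqSmallOn S e`, it is available at every base field
of the guard `PlaqSmallOn S e'`. [cite: Balaban1989LargeFieldI, Prop. 1 p.194 («for ε > 0 sufficiently small»; bookkeeping); Balaban1988Convergent, (1.4) p.247] -/
theorem guard_antitone {S : Set (Plaq P j)} {e e' : ℝ} (h : e' ≤ e) {Q : GaugeField P j G → Prop}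
    (hQ : ∀ V : GaugeField P j G, PlaqSmallOn S e V → Q V) :
    ∀ V : GaugeField P j G, PlaqSmallOn S e' V → Q V :=
  fun V hV => hQ V (plaqSmallOn_of_le h hV)

end Antitone

/-! ## §6  (v1.1) The numerics of the DIRECT road (LOCATED-DIRECT, plan g87 ruling «(b-direct) GO»): `Cerr = (32(d−1)δc + 8(d−1)εc + μc)·Kc² + τc` -/

section Direct

/-- ★★ **THE DIRECT `hsm` FROM MODULI AND ONE SCALAR INEQUALITY.**  If `δc ≤ δ` (window near-flatness), `εc ≤ Cε·δ` (plaquette smallness off the window), `μc ≤ Cμ·δ`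
(multiplier row), `τc ≤ Cτ·δ` (Federbush-at-the-velocity defect), `1 ≤ d`, and `δ·S ≤ rhs` for `S := (32(d−1) + 8(d−1)·Cε + Cμ)·Kc² + Cτ`, then the direct
socket's `hsm` body `(32(d−1)·δc + 8(d−1)·εc + μc)·Kc² + τc ≤ rhs` holds (the body of `B15Prop1EndpointNearFlatLettersWindow.hcoer_of_windowLettersDirect_normalised_box`'s
`hsm`).  Neither `0 ≤ δ` nor `δ ≤ 1` is needed: the direct constant is LINEAR in the moduli.
[cite: Balaban1989LargeFieldII, (1.7)–(1.9) p.358 (bookkeeping of the error constant); Balaban1989LargeFieldI, Prop. 1 p.194 («for ε > 0 sufficiently small»)] -/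
theorem hsm_direct_of_moduli_of_le {d : ℕ} (hd : 1 ≤ d) {δ δc εc μc Kc τc Cε Cμ Cτ rhs : ℝ}
    (hδc : δc ≤ δ) (hεc : εc ≤ Cε * δ) (hμc : μc ≤ Cμ * δ) (hτ : τc ≤ Cτ * δ)
    (hS : δ * ((32 * ((d : ℝ) - 1) + 8 * ((d : ℝ) - 1) * Cε + Cμ) * Kc ^ 2 + Cτ) ≤ rhs) :
    (32 * ((d : ℝ) - 1) * δc + 8 * ((d : ℝ) - 1) * εc + μc) * Kc ^ 2 + τc ≤ rhs := by
  have hd' : (0 : ℝ) ≤ (d : ℝ) - 1 := by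
    have : (1 : ℝ) ≤ (d : ℝ) := by exact_mod_cast hd
    linarith
  have h1 : 32 * ((d : ℝ) - 1) * δc ≤ 32 * ((d : ℝ) - 1) * δ := mul_le_mul_of_nonneg_left hδc (by positivity)
  have h2 : 8 * ((d : ℝ) - 1) * εc ≤ 8 * ((d : ℝ) - 1) * (Cε * δ) := mul_le_mul_of_nonneg_left hεc (by positivity)
  have hbr : 32 * ((d : ℝ) - 1) * δc + 8 * ((d : ℝ) - 1) * εc + μc ≤ δ * (32 * ((d : ℝ) - 1) + 8 * ((d : ℝ) - 1) * Cε + Cμ) := by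
    have he : δ * (32 * ((d : ℝ) - 1) + 8 * ((d : ℝ) - 1) * Cε + Cμ) = 32 * ((d : ℝ) - 1) * δ + 8 * ((d : ℝ) - 1) * (Cε * δ) + Cμ * δ := by ring
    rw [he]; linarith
  have hbrK : (32 * ((d : ℝ) - 1) * δc + 8 * ((d : ℝ) - 1) * εc + μc) * Kc ^ 2 ≤ δ * (32 * ((d : ℝ) - 1) + 8 * ((d : ℝ) - 1) * Cε + Cμ) * Kc ^ 2 :=
    mul_le_mul_of_nonneg_right hbr (sq_nonneg _)
  have he2 : δ * (32 * ((d : ℝ) - 1) + 8 * ((d : ℝ) - 1) * Cε + Cμ) * Kc ^ 2 + Cτ * δ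
      = δ * ((32 * ((d : ℝ) - 1) + 8 * ((d : ℝ) - 1) * Cε + Cμ) * Kc ^ 2 + Cτ) := by ring
  linarith

/-- ★★★ **THE DIRECT `hsm` LETTER IS INHABITABLE: a positive threshold on the moduli.**  For `1 ≤ d`, `1 ≤ K`, any `Kc Cε Cμ Cτ` and `0 < γ₀` there is `δ₀ ∈ (0, 1]` such that for every
`δ ∈ [0, δ₀]` and all `δc εc μc τc` with `δc ≤ δ`, `εc ≤ Cε·δ`, `μc ≤ Cμ·δ`, `τc ≤ Cτ·δ` the direct `hsm` body `(32(d−1)δc + 8(d−1)εc + μc)·Kc² + τc ≤ γ₀ ∕ (2(3K² + 2K⁴))` holds.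
[cite: Balaban1989LargeFieldI, Prop. 1 p.194 («for ε > 0 sufficiently small»); Balaban1989LargeFieldII, (1.7)–(1.9) p.358 (bookkeeping)] -/
theorem exists_delta_hsm_direct {d K : ℕ} (hd : 1 ≤ d) (hK : 1 ≤ K) {γ₀ : ℝ} (Kc Cε Cμ Cτ : ℝ) (hγ₀ : 0 < γ₀) :
    ∃ δ₀ : ℝ, 0 < δ₀ ∧ δ₀ ≤ 1 ∧ ∀ δ δc εc μc τc : ℝ, 0 ≤ δ → δ ≤ δ₀ →
      δc ≤ δ → εc ≤ Cε * δ → μc ≤ Cμ * δ → τc ≤ Cτ * δ →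
      (32 * ((d : ℝ) - 1) * δc + 8 * ((d : ℝ) - 1) * εc + μc) * Kc ^ 2 + τc ≤ γ₀ / (2 * (3 * (K : ℝ) ^ 2 + 2 * (K : ℝ) ^ 4)) := by
  obtain ⟨δ₀, hδ₀, hδ₀1, hall⟩ :=
    exists_smallness_threshold ((32 * ((d : ℝ) - 1) + 8 * ((d : ℝ) - 1) * Cε + Cμ) * Kc ^ 2 + Cτ) (rhs_pos hK hγ₀)
  refine ⟨δ₀, hδ₀, hδ₀1, fun δ δc εc μc τc hδ hδle hδc hεc hμc hτ => ?_⟩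
  exact hsm_direct_of_moduli_of_le hd hδc hεc hμc hτ (hall δ hδ hδle)

/-- ★★★ **THE SAME FOR AN INSTANCE FAMILY**: per instance `i` a threshold `δ₀ i ∈ (0,1]` (by `choose`), for `δ`-free families `K i ≥ 1`, `Kc Cε Cμ Cτ`.
[cite: Balaban1989LargeFieldI, Prop. 1 p.194 («for ε > 0 sufficiently small», the threshold may depend on the instance); Balaban1989LargeFieldII, (1.7)–(1.9) p.358] -/
theorem exists_delta_hsm_direct_family {ι : Type*} {d : ℕ} (hd : 1 ≤ d) (K : ι → ℕ) (hK : ∀ i, 1 ≤ K i)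
    (Kc Cε Cμ Cτ : ι → ℝ) {γ₀ : ℝ} (hγ₀ : 0 < γ₀) :
    ∃ δ₀ : ι → ℝ, (∀ i, 0 < δ₀ i) ∧ (∀ i, δ₀ i ≤ 1) ∧ ∀ i (δ δc εc μc τc : ℝ), 0 ≤ δ → δ ≤ δ₀ i →
      δc ≤ δ → εc ≤ Cε i * δ → μc ≤ Cμ i * δ → τc ≤ Cτ i * δ →
      (32 * ((d : ℝ) - 1) * δc + 8 * ((d : ℝ) - 1) * εc + μc) * Kc i ^ 2 + τc ≤ γ₀ / (2 * (3 * (K i : ℝ) ^ 2 + 2 * (K i : ℝ) ^ 4)) := by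
  choose δ₀ h0 h1 hall using fun i => exists_delta_hsm_direct hd (hK i) (Kc i) (Cε i) (Cμ i) (Cτ i) hγ₀
  exact ⟨δ₀, h0, h1, hall⟩

/-- ★★ **THE DIRECT `hsm` WITH A FIXED (CLASS-BASED) PLAQUETTE TOLERANCE**: when `εc` does NOT scale with the guard (the class road: `εc = εreg·η²` of the (2.12) class), the
direct `hsm` body follows from `δc ≤ δ`, `μc ≤ Cμ·δ`, `τc ≤ Cτ·δ` and the TWO displayed scalar inequalities `δ·S′ ≤ rhs∕2` (`S′ := (32(d−1) + Cμ)·Kc² + Cτ`) and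
`8(d−1)·εc·Kc² ≤ rhs∕2` — the second is the closers' condition «`εreg` below the instance threshold».
[cite: Balaban1989LargeFieldII, (1.7)–(1.9) p.358 (bookkeeping); Balaban1989LargeFieldI, Prop. 1 p.194; Balaban1988Convergent, (2.12) p.256 (the class tolerance)] -/
theorem hsm_direct_of_moduli_of_fixed_plaq {d : ℕ} (hd : 1 ≤ d) {δ δc εc μc Kc τc Cμ Cτ rhs : ℝ}
    (hδc : δc ≤ δ) (hμc : μc ≤ Cμ * δ) (hτ : τc ≤ Cτ * δ)
    (hS : δ * ((32 * ((d : ℝ) - 1) + Cμ) * Kc ^ 2 + Cτ) ≤ rhs / 2) (hε : 8 * ((d : ℝ) - 1) * εc * Kc ^ 2 ≤ rhs / 2) :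
    (32 * ((d : ℝ) - 1) * δc + 8 * ((d : ℝ) - 1) * εc + μc) * Kc ^ 2 + τc ≤ rhs := by
  have hd' : (0 : ℝ) ≤ (d : ℝ) - 1 := by
    have : (1 : ℝ) ≤ (d : ℝ) := by exact_mod_cast hd
    linarith
  have h1 : 32 * ((d : ℝ) - 1) * δc ≤ 32 * ((d : ℝ) - 1) * δ := mul_le_mul_of_nonneg_left hδc (by positivity)
  have hbr : 32 * ((d : ℝ) - 1) * δc + μc ≤ δ * (32 * ((d : ℝ) - 1) + Cμ) := by
    have he : δ * (32 * ((d : ℝ) - 1) + Cμ) = 32 * ((d : ℝ) - 1) * δ + Cμ * δ := by ring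
    rw [he]; linarith
  have hbrK : (32 * ((d : ℝ) - 1) * δc + μc) * Kc ^ 2 ≤ δ * (32 * ((d : ℝ) - 1) + Cμ) * Kc ^ 2 := mul_le_mul_of_nonneg_right hbr (sq_nonneg _)
  have he2 : (32 * ((d : ℝ) - 1) * δc + 8 * ((d : ℝ) - 1) * εc + μc) * Kc ^ 2 + τc
      = (32 * ((d : ℝ) - 1) * δc + μc) * Kc ^ 2 + 8 * ((d : ℝ) - 1) * εc * Kc ^ 2 + τc := by ring
  have he3 : δ * ((32 * ((d : ℝ) - 1) + Cμ) * Kc ^ 2 + Cτ) = δ * (32 * ((d : ℝ) - 1) + Cμ) * Kc ^ 2 + Cτ * δ := by ring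
  rw [he2]
  linarith

end Direct

/-! ## §7  (v1.2) The EXPLICIT direct threshold — no `∃` (lane finding LOCATED-FLOOR) -/

section Explicit

/-- The closed-form threshold `min 1 (rhs ∕ (max S 0 + 1))` is positive for `0 < rhs` (any real `S`). [cite: Balaban1989LargeFieldI, Prop. 1 p.194 («for ε > 0 sufficiently small»; bookkeeping)] -/
theorem explicitThreshold_pos (S : ℝ) {rhs : ℝ} (hrhs : 0 < rhs) : 0 < min 1 (rhs / (max S 0 + 1)) :=
  lt_min one_pos (div_pos hrhs (by positivity))

/-- The closed-form threshold is at most `1`. [cite: Balaban1989LargeFieldI, Prop. 1 p.194 (bookkeeping)] -/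
theorem explicitThreshold_le_one (S rhs : ℝ) : min 1 (rhs / (max S 0 + 1)) ≤ 1 := min_le_left _ _

/-- ★★ **BELOW THE CLOSED-FORM THRESHOLD THE SCALAR INEQUALITY HOLDS**: `0 ≤ δ ≤ min 1 (rhs ∕ (max S 0 + 1))` and `0 < rhs` give `δ·S ≤ rhs`.
[cite: Balaban1989LargeFieldI, Prop. 1 p.194 («for ε > 0 sufficiently small»; bookkeeping)] -/
theorem mul_le_of_le_explicitThreshold {S rhs δ : ℝ} (hrhs : 0 < rhs) (hδ0 : 0 ≤ δ) (hδ : δ ≤ min 1 (rhs / (max S 0 + 1))) :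
    δ * S ≤ rhs := by
  have hD : 0 < max S 0 + 1 := by positivity
  have hδ' : δ ≤ rhs / (max S 0 + 1) := hδ.trans (min_le_right _ _)
  have h1 : δ * S ≤ δ * max S 0 := mul_le_mul_of_nonneg_left (le_max_left _ _) hδ0
  have h2 : δ * max S 0 ≤ rhs / (max S 0 + 1) * max S 0 := mul_le_mul_of_nonneg_right hδ' (le_max_right _ _)
  have h3 : rhs / (max S 0 + 1) * max S 0 ≤ rhs := by
    rw [div_mul_eq_mul_div, div_le_iff₀ hD]
    nlinarith [le_max_right S 0]
  linarith

/-- ★★★ **THE DIRECT `hsm` BELOW THE EXPLICIT THRESHOLD** — `exists_delta_hsm_direct` with the threshold SPELLED OUT: for `1 ≤ d`, `1 ≤ K`, `0 < γ₀`, any `Kc Cε Cμ Cτ`, every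
`δ` with `0 ≤ δ ≤ min 1 (rhs ∕ (max S 0 + 1))` — `rhs := γ₀ ∕ (2(3K² + 2K⁴))`, `S := (32(d−1) + 8(d−1)·Cε + Cμ)·Kc² + Cτ` — and all moduli rows `δc ≤ δ`, `εc ≤ Cε·δ`, `μc ≤ Cμ·δ`,
`τc ≤ Cτ·δ`, the direct `hsm` body `(32(d−1)δc + 8(d−1)εc + μc)·Kc² + τc ≤ γ₀ ∕ (2(3K² + 2K⁴))` holds.  With this the endpoint's threshold frame is stated WITHOUT `∃ δ₀` and the
class-threshold floor «`εreg`-tolerance `≤ δ`» is compared with a CLOSED-FORM bound (LOCATED-FLOOR: the `∃ δ₀`-vs-floor frame is vacuous by shape).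
[cite: Balaban1989LargeFieldI, Prop. 1 p.194 («for ε > 0 sufficiently small»); Balaban1989LargeFieldII, (1.7)–(1.9) p.358 (bookkeeping of the error constant)] -/
theorem hsm_direct_of_le_explicitThreshold {d K : ℕ} (hd : 1 ≤ d) (hK : 1 ≤ K) {γ₀ : ℝ} (hγ₀ : 0 < γ₀) (Kc Cε Cμ Cτ : ℝ)
    {δ δc εc μc τc : ℝ} (hδ0 : 0 ≤ δ)
    (hδ : δ ≤ min 1 (γ₀ / (2 * (3 * (K : ℝ) ^ 2 + 2 * (K : ℝ) ^ 4)) /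
      (max ((32 * ((d : ℝ) - 1) + 8 * ((d : ℝ) - 1) * Cε + Cμ) * Kc ^ 2 + Cτ) 0 + 1)))
    (hδc : δc ≤ δ) (hεc : εc ≤ Cε * δ) (hμc : μc ≤ Cμ * δ) (hτ : τc ≤ Cτ * δ) :
    (32 * ((d : ℝ) - 1) * δc + 8 * ((d : ℝ) - 1) * εc + μc) * Kc ^ 2 + τc ≤ γ₀ / (2 * (3 * (K : ℝ) ^ 2 + 2 * (K : ℝ) ^ 4)) :=
  hsm_direct_of_moduli_of_le hd hδc hεc hμc hτ (mul_le_of_le_explicitThreshold (rhs_pos hK hγ₀) hδ0 hδ)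

/-- ★★ **THE FAMILY FORM, STILL WITHOUT `∃`**: for an instance family, at per-instance constants `K i ≥ 1`, `Kc i Cε i Cμ i Cτ i`, every tolerance family `δ` with
`0 ≤ δ i ≤ min 1 (rhs_i ∕ (max S_i 0 + 1))` and the moduli rows satisfies the direct `hsm` body at every `i` — the shape the endpoints display (`∀ δ ≤ Θ`, `Θ` explicit).
[cite: Balaban1989LargeFieldI, Prop. 1 p.194 («for ε > 0 sufficiently small», the threshold may depend on the instance); Balaban1989LargeFieldII, (1.7)–(1.9) p.358] -/
theorem hsm_direct_family_of_le_explicitThreshold {ι : Type*} {d : ℕ} (hd : 1 ≤ d) (K : ι → ℕ) (hK : ∀ i, 1 ≤ K i) {γ₀ : ℝ} (hγ₀ : 0 < γ₀)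
    (Kc Cε Cμ Cτ : ι → ℝ) (δ δc εc μc τc : ι → ℝ) (hδ0 : ∀ i, 0 ≤ δ i)
    (hδ : ∀ i, δ i ≤ min 1 (γ₀ / (2 * (3 * (K i : ℝ) ^ 2 + 2 * (K i : ℝ) ^ 4)) /
      (max ((32 * ((d : ℝ) - 1) + 8 * ((d : ℝ) - 1) * Cε i + Cμ i) * Kc i ^ 2 + Cτ i) 0 + 1)))
    (hδc : ∀ i, δc i ≤ δ i) (hεc : ∀ i, εc i ≤ Cε i * δ i) (hμc : ∀ i, μc i ≤ Cμ i * δ i) (hτ : ∀ i, τc i ≤ Cτ i * δ i) (i : ι) :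
    (32 * ((d : ℝ) - 1) * δc i + 8 * ((d : ℝ) - 1) * εc i + μc i) * Kc i ^ 2 + τc i ≤ γ₀ / (2 * (3 * (K i : ℝ) ^ 2 + 2 * (K i : ℝ) ^ 4)) :=
  hsm_direct_of_le_explicitThreshold hd (hK i) hγ₀ (Kc i) (Cε i) (Cμ i) (Cτ i) (hδ0 i) (hδ i) (hδc i) (hεc i) (hμc i) (hτ i)

/-- ★ **THE OLD `∃`-FRAME IS AN INSTANCE** (sanity junction): `exists_delta_hsm_direct`'s threshold may be taken to be the explicit one.
[cite: Balaban1989LargeFieldI, Prop. 1 p.194 (bookkeeping)] -/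
theorem exists_delta_hsm_direct_eq_explicit {d K : ℕ} (hd : 1 ≤ d) (hK : 1 ≤ K) {γ₀ : ℝ} (Kc Cε Cμ Cτ : ℝ) (hγ₀ : 0 < γ₀) :
    ∃ δ₀ : ℝ, δ₀ = min 1 (γ₀ / (2 * (3 * (K : ℝ) ^ 2 + 2 * (K : ℝ) ^ 4)) /
        (max ((32 * ((d : ℝ) - 1) + 8 * ((d : ℝ) - 1) * Cε + Cμ) * Kc ^ 2 + Cτ) 0 + 1)) ∧ 0 < δ₀ ∧ δ₀ ≤ 1 ∧
      ∀ δ δc εc μc τc : ℝ, 0 ≤ δ → δ ≤ δ₀ → δc ≤ δ → εc ≤ Cε * δ → μc ≤ Cμ * δ → τc ≤ Cτ * δ →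
      (32 * ((d : ℝ) - 1) * δc + 8 * ((d : ℝ) - 1) * εc + μc) * Kc ^ 2 + τc ≤ γ₀ / (2 * (3 * (K : ℝ) ^ 2 + 2 * (K : ℝ) ^ 4)) :=
  ⟨_, rfl, explicitThreshold_pos _ (rhs_pos hK hγ₀), explicitThreshold_le_one _ _,
    fun _ _ _ _ _ hδ0 hδ hδc hεc hμc hτ => hsm_direct_of_le_explicitThreshold hd hK hγ₀ Kc Cε Cμ Cτ hδ0 hδ hδc hεc hμc hτ⟩

/-- ★★ **WHY THE `∃ δ₀`-VS-FLOOR FRAME HAD TO GO (kernel certificate of LOCATED-FLOOR)**: for ANY conclusion `C`, a frame `∃ δ₀ > 0, ∀ δ, (0 < δ i) → (δ i ≤ δ₀ i) → (tol i ≤ δ i) → C δ`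
is provable as soon as ONE floor `tol i₀` is positive — take `δ₀ := tol ∕ 2` (or `1` where `tol ≤ 0`).  A floor fixed by outer data (class threshold, datum tolerance) therefore
makes such an endpoint vacuous by shape; the explicit-threshold frame above is the repair. [cite: Balaban1989LargeFieldI, Prop. 1 p.194 (bookkeeping; typing-strength hygiene)] -/
theorem exists_threshold_frame_of_pos_floor {ι : Type*} (i₀ : ι) (tol : ι → ℝ) (htol : 0 < tol i₀) (C : (ι → ℝ) → Prop) :
    ∃ δ₀ : ι → ℝ, (∀ i, 0 < δ₀ i) ∧ ∀ δ : ι → ℝ, (∀ i, 0 < δ i) → (∀ i, δ i ≤ δ₀ i) → (∀ i, tol i ≤ δ i) → C δ := by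
  refine ⟨fun i => if 0 < tol i then tol i / 2 else 1, fun i => ?_, fun δ _ hle hfloor => ?_⟩
  · by_cases h : 0 < tol i
    · simp only [h, if_true]; linarith
    · simp only [h, if_false]; norm_num
  · have h1 := hle i₀
    have h2 := hfloor i₀
    simp only [htol, if_true] at h1
    exact absurd (h2.trans h1) (by linarith)

end Explicit

end Literature.MathematicalPhysics.QuantumFieldTheory.Balaban1983to89.B15Prop1NumericsThresholds

end
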